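/-
Copyright (c) 2026. All rights reserved.
Released under Apache 2.0 license as described in the file LICENSE.
Authors: abc-iut cell, statement-typer seat abc-iut-L4-t3 (wave 1; gen 8), over abc-iut-f-101's frames
(`LogFrobeniusMonoTelecoreFrames/FrameIsos/FrameLifts/Precomp/Postcomp/Contact`) and abc-iut-L4-t5's relative families.
-/
import Literature.AnabelianGeometry.AbsoluteAnabelian.Ltimes.LogFrobeniusIotaAnMonoChains
import Literature.AnabelianGeometry.AbsoluteAnabelian.Ltimes.LogFrobeniusMonoTelecorePinnedIota
import Literature.AnabelianGeometry.AbsoluteAnabelian.LogFrobeniusMonoTelecoreIotaFrames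
import HarnessLib

/-!
# [AbsTopIII] Cor 5.10 (iv)(c): the contact structure `ℋ_{An⊢}` EXTENDED by the `ι^{An⊢⊞}`-generators — the relative family

S. Mochizuki, *Topics in absolute anabelian geometry III*, J. Math. Sci. Univ. Tokyo 22 (2015) 939–1156
[MochizukiAbsTopIII2015]; manuscript pages (`paper:url-5493eb38cbb7`): Cor 5.10 (iv)(c) p. 148 l. 39–51 ("the resulting
homotopies `η⊢_{v,ν}`, `(η⊢_{v,ν})⁻¹`, together with … the homotopies on `D_{An⊢}` arising from the `ι^{An⊢⊞}_{v,ε}` … generate a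
contact structure `ℋ_{An⊢}`"); Def 3.5 (ii) p. 75, (iv) p. 76; §0 p. 26 (saturation); Rmk 3.5.1 p. 78.

WHY («F-0139″-CLOSER», second brick; proof-side companion of `LogFrobeniusMonoTelecorePinnedIota.lean`, nothing restated).
abc-iut-f-101's `monoContact` relates two paths into `𝒩⊢⊞_v` only inside ONE class `A_ν` (`MRel`), by the frame ISOMORPHISM
`Θ_p ≫ Θ_q⁻¹`; the `ι^{An⊢⊞}`-pair `([φ_{ν₁}], [φ_{ν₂}])` joins two classes by a non-invertible homotopy.  Here the relative lifts
are EXTENDED over the `ι^{An⊢⊞}`-data `I` (this lineage's `IotaAnMono`):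
* `MRelI` — at `𝒩⊢⊞_v`: `p ∈ A_{ν₁}`, `q ∈ A_{ν₂}` with `ν₁ ⤳ ν₂` REACHABLE in `Γ⃗×_v` (`LogFrobeniusIotaAnMonoChains`); all pairs
  at the core vertex; closed under the saturation moves (`mrelI_*`);
* `θI := Θ_p ≫ (N_a ◁ ι^{An⊢⊞}_{ν₁ ⤳ ν₂}) ≫ Θ_q⁻¹` (abc-iut-f-101's frames, this lineage's `IotaAnMono.chain`); `θI_eq` (any
  witnesses), `θI_eq_θAt` (on a same-class pair it IS `θAt`); the laws of Def 3.5 (ii): `θI_self`, `θI_trans` UNDER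
  `I.SquaresCommute` (Def 5.4 (iii): one composite per reachable pair), `θI_precomp_heq` (naturality of the chain), and
  `θI_over` — `θI` lies over the structure isomorphisms EXACTLY as `θAt` (`ι^{An⊢⊞}` lies over the identity of `Th⊢[Z]`,
  `chain_over`), whence post-composition by abc-iut-f-101's generic `lift_comp_heq_of_over` / `θAt_comp_tel_heq`;
The `RelLifts` datum, the family `ℋ_{An⊢}` with the `ι^{An⊢⊞}`-generators, its compatibility with `𝒥`, the printed pairs and
`Cor510MonoTelecorePinnedIota` follow in the third brick (`LogFrobeniusMonoTelecoreIotaContact.lean`).  Hypotheses: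
abc-iut-f-101's `hN`, `hψ`, `hη`, `hcoh`, the data `I` over `hψ`, `I.SquaresCommute`; NOT `EtaNatural` (it constrains `ℋ_{An⊢}`
against the observables `S_log⊞`, abc-iut-w5-d144's lane).  Refereed pre-IUT material; OUR constructions over a typed
interface; nothing here bears on [IUTchIII] Cor. 3.12; no side taken; typed ≠ proved.

**`⋉`-TWIN (cell row «LTIMES-SUCCESSOR», L4-lead m162; typing finding T3g9-F1).**  This file is the verbatim
re-elaboration of `LogFrobeniusMonoTelecoreIotaFrames.lean` over the successor interface `LogFrobeniusSettingLtimes`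
(`Ltimes/LogFrobeniusCompatibility.lean`: `ι⊞_{v,ε}` indexed by the edges of `Γ⃗^⋉_v` at EVERY place, [AbsTopIII] Cor 5.5 (iii)
p. 131), produced by the cell recipe `LTIMES-RECIPE.md`: names carry over inside `namespace LogFrobeniusSettingLtimes`, the
section variable is `Lt`, setting-independent declarations are NOT repeated (the originals are in scope), statements and
proofs are otherwise unchanged.  The original file over the frozen interface stays as it is.
-/

set_option autoImplicit false

universe u

open CategoryTheory Quiver

namespace Literature.AnabelianGeometry.AbsoluteAnabelian

namespace LogFrobeniusSettingLtimes

variable {Vmod : Type u} {isArc : Vmod → Bool}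

/-! (The extended relation `MRelI` on paths and its laws are the frozen file's, reused.) -/

/-! ## The extended lift `θI` at `𝒩⊢⊞_v` -/

export LogFrobeniusSetting (MRelI mrelI_nmonoPlus_iff mrelI_of_mrel mrelI_refl_left mrelI_refl_right mrelI_trans mrelI_precomp mrelI_postcomp mrelI_cons_telE)

variable (Lt : LogFrobeniusSettingLtimes Vmod isArc)
  (hN : ∀ v : Vmod, Lt.monoN v ⋙ Lt.toEmono v ≅ Lt.toE v ⋙ Lt.monoAn)
  (hψ : ∀ (w : Vmod) (j : {ν : LogVertex (isArc w) // ν.IsCross}),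
    Lt.ψAnMono w j ⋙ Lt.forgetMono w ⋙ Lt.toEmono w ≅ Lt.κAnMono.inverse)
  (hη : ∀ (v : Vmod) (ν : LogVertex (isArc v)) (hν : ν.IsCross),
    Lt.lam v ν ⋙ Lt.forget v ⋙ Lt.toE v ⋙ Lt.monoAn ⋙ Lt.κAnMono.functor ⋙ Lt.ψAnMono v ⟨ν, hν⟩ ≅ Lt.lam v ν ⋙ Lt.monoNplus v)
  (Ia : Lt.IotaAnMono hψ)

-- the coherence hypothesis `hcoh`: «`η⊢_{v,ν}` lies over `ℰ⊢`» (abc-iut-f-101's binder, verbatim)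
variable (hcoh : ∀ (v : Vmod) (ν : LogVertex (isArc v)) (hν : ν.IsCross) (y : Lt.X),
  (Lt.toEmono v).map ((Lt.forgetMono v).map ((hη v ν hν).hom.app y)) ≫
    (Lt.toEmono v).map ((Lt.monoHomotopy v).hom.app ((Lt.lam v ν).obj y)) ≫
      (hN v).hom.app ((Lt.forget v).obj ((Lt.lam v ν).obj y)) =
  (hψ v ⟨ν, hν⟩).hom.app ((Lt.lam v ν ⋙ Lt.forget v ⋙ Lt.toE v ⋙ Lt.monoAn ⋙ Lt.κAnMono.functor).obj y) ≫
    Lt.κAnMono.unitIso.inv.app ((Lt.lam v ν ⋙ Lt.forget v ⋙ Lt.toE v ⋙ Lt.monoAn).obj y))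

section Theta

variable {v : Vmod} {a : (monoTeleShape Vmod isArc).Vertex}

/-- **the extended relative lift at `𝒩⊢⊞_v`**: for `p ∈ A_{ν₁}`, `q ∈ A_{ν₂}`, `ν₁ ⤳ ν₂`, the frame of `p`, then `ι^{An⊢⊞}` along
`ν₁ ⤳ ν₂` under the structure functor of the source vertex, then the inverse frame of `q` (on a same-class pair: abc-iut-f-101's
`θAt`). [cite: MochizukiAbsTopIII2015, Definition 3.5 (ii) p.75] -/
noncomputable def θI {p q : Path a (nmonoPlusVx v)} (hr : MRelI p q) :
    Lt.monoTeleDiagram.pathFunctor p ⟶ Lt.monoTeleDiagram.pathFunctor q :=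
  (Lt.Θ hN hψ hη ((mrelI_nmonoPlus_iff p q).mp hr).choose_spec.choose_spec.choose_spec.choose_spec.1.wit).hom ≫
    Functor.whiskerLeft ((Lt.monoTeleOver hN hψ).N a)
      (Ia.chain v ((mrelI_nmonoPlus_iff p q).mp hr).choose_spec.choose_spec.choose_spec.choose_spec.2.2) ≫
    (Lt.Θ hN hψ hη ((mrelI_nmonoPlus_iff p q).mp hr).choose_spec.choose_spec.choose_spec.choose_spec.2.1.wit).inv

/-- the extended lift computed from ANY witnesses. [cite: MochizukiAbsTopIII2015, Definition 3.5 (ii) p.75] -/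
theorem θI_eq {p q : Path a (nmonoPlusVx v)} (hr : MRelI p q) {ν₁ ν₂ : LogVertex (isArc v)} {hν₁ : ν₁.IsCross}
    {hν₂ : ν₂.IsCross} (wp : TelWit v ν₁ hν₁ p ⊕ LamWit v ν₁ hν₁ p) (wq : TelWit v ν₂ hν₂ q ⊕ LamWit v ν₂ hν₂ q)
    (h : ν₁.Reach ν₂) :
    Lt.θI hN hψ hη Ia hr = (Lt.Θ hN hψ hη wp).hom ≫
      Functor.whiskerLeft ((Lt.monoTeleOver hN hψ).N a) (Ia.chain v h) ≫ (Lt.Θ hN hψ hη wq).inv := by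
  obtain rfl : ν₁ = ((mrelI_nmonoPlus_iff p q).mp hr).choose :=
    (inA_of_wit wp).ν_eq ((mrelI_nmonoPlus_iff p q).mp hr).choose_spec.choose_spec.choose_spec.choose_spec.1
  obtain rfl : ν₂ = ((mrelI_nmonoPlus_iff p q).mp hr).choose_spec.choose :=
    (inA_of_wit wq).ν_eq ((mrelI_nmonoPlus_iff p q).mp hr).choose_spec.choose_spec.choose_spec.choose_spec.2.1
  unfold θI
  rw [Lt.Θ_eq hN hψ hη _ wp, Lt.Θ_eq hN hψ hη _ wq]

/-- **on a same-class pair the extended lift IS abc-iut-f-101's `θAt`** (`ι^{An⊢⊞}` along `ν ⤳ ν` is the identity).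
[cite: MochizukiAbsTopIII2015, Definition 3.5 (ii) p.75] -/
theorem θI_eq_θAt {p q : Path a (nmonoPlusVx v)} (hr : MRelI p q) (hr' : MRel p q) :
    Lt.θI hN hψ hη Ia hr = Lt.θAt hN hψ hη hr' := by
  obtain ⟨ν, hν, hp, hq⟩ := (mrel_nmonoPlus_iff p q).mp hr'
  rw [Lt.θI_eq hN hψ hη Ia hr hp.wit hq.wit (LogVertex.Reach.refl hν), Lt.θAt_eq hN hψ hη hr' hp.wit hq.wit,
    Ia.chain_refl]
  erw [Functor.whiskerLeft_id', Category.id_comp]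

/-- identity law. [cite: MochizukiAbsTopIII2015, Definition 3.5 (ii) p.75] -/
theorem θI_self {p : Path a (nmonoPlusVx v)} (hr : MRelI p p) : Lt.θI hN hψ hη Ia hr = 𝟙 _ := by
  obtain ⟨ν₁, -, hν₁, -, hp, -, -⟩ := (mrelI_nmonoPlus_iff p p).mp hr
  rw [Lt.θI_eq_θAt hN hψ hη Ia hr ⟨ν₁, hν₁, hp, hp⟩, Lt.θAt_self]

/-- **composition law, under the `ι^{An⊢⊞}`-square** (the composites along `ν₁ ⤳ ν₂ ⤳ ν₃` and `ν₁ ⤳ ν₃` agree).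
[cite: MochizukiAbsTopIII2015, Definition 3.5 (ii) p.75] -/
theorem θI_trans (hsq : Ia.SquaresCommute) {p q r : Path a (nmonoPlusVx v)} (h₁ : MRelI p q) (h₂ : MRelI q r)
    (h₃ : MRelI p r) : Lt.θI hN hψ hη Ia h₁ ≫ Lt.θI hN hψ hη Ia h₂ = Lt.θI hN hψ hη Ia h₃ := by
  obtain ⟨ν₁, ν₂, hν₁, hν₂, hp, hq, h12⟩ := (mrelI_nmonoPlus_iff p q).mp h₁
  obtain ⟨ν₂', ν₃, hν₂', hν₃, hq', hr', h23⟩ := (mrelI_nmonoPlus_iff q r).mp h₂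
  obtain rfl : ν₂ = ν₂' := hq.ν_eq hq'
  rw [Lt.θI_eq hN hψ hη Ia h₁ hp.wit hq.wit h12, Lt.θI_eq hN hψ hη Ia h₂ hq.wit hr'.wit h23,
    Lt.θI_eq hN hψ hη Ia h₃ hp.wit hr'.wit (h12.trans h23)]
  simp only [Category.assoc, Iso.inv_hom_id_assoc]
  rw [← Category.assoc (Functor.whiskerLeft _ _) (Functor.whiskerLeft _ _), ← Functor.whiskerLeft_comp]
  erw [Ia.chain_trans hsq v h12 h23 (h12.trans h23)]

/-! ### `θI` lies over the structure isomorphisms -/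

/-- the structure isomorphism of a telecore edge, its image of the chain: `μ_{φ_{ν₁}}⁻¹ ≫ N(ι^{An⊢⊞}_{ν₁⤳ν₂}) ≫ μ_{φ_{ν₂}} = 𝟙`
in the core category — because `ι^{An⊢⊞}` lies over the identity of `Th⊢[Z]` (`chain_over`) and `μ_{φ_ν}` is made of `hψ_ν`
(`μ_telE_app`). [cite: MochizukiAbsTopIII2015, Prop 5.8 (vii) p.142] -/
theorem map_chain_app_comp_μ {ν₁ ν₂ : LogVertex (isArc v)} (h : ν₁.Reach ν₂) (X : Lt.AnMono) :
    ((Lt.monoTeleOver hN hψ).N (nmonoPlusVx v)).map ((Ia.chain v h).app X) ≫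
        ((Lt.monoTeleOver hN hψ).μ (telE v ν₂ h.isCross_tgt)).hom.app X =
      ((Lt.monoTeleOver hN hψ).μ (telE v ν₁ h.isCross_src)).hom.app X := by
  rw [Lt.μ_telE_app hN hψ, Lt.μ_telE_app hN hψ]
  change Lt.κAnMono.functor.map ((Lt.toEmono v).map ((Lt.forgetMono v).map ((Ia.chain v h).app X))) ≫ _ = _
  rw [Ia.chain_over v h X]
  erw [← Functor.map_comp_assoc]
  erw [Category.assoc, Iso.inv_hom_id_app, Category.comp_id]
  rfl

include hcoh in
/-- **the extended lift lies over the structure isomorphisms**, with the SAME formula as abc-iut-f-101's `θAt_over`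
(Rmk 3.5.1: under the structure functor of `𝒩⊢⊞_v` the chain contributes nothing). [cite: MochizukiAbsTopIII2015, Remark 3.5.1 p.78] -/
theorem θI_over {p q : Path a (nmonoPlusVx v)} (hr : MRelI p q) (x : Lt.monoTeleDiagram.obj a) :
    ((Lt.monoTeleOver hN hψ).N (nmonoPlusVx v)).map ((Lt.θI hN hψ hη Ia hr).app x) =
      ((Lt.monoTeleOver hN hψ).pathIso p).hom.app x ≫ ((Lt.monoTeleOver hN hψ).pathIso q).inv.app x := by
  obtain ⟨ν₁, ν₂, hν₁, hν₂, hp, hq, h12⟩ := (mrelI_nmonoPlus_iff p q).mp hr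
  rw [Lt.θI_eq hN hψ hη Ia hr hp.wit hq.wit h12, NatTrans.comp_app, NatTrans.comp_app, Functor.map_comp,
    Functor.map_comp, Functor.whiskerLeft_app]
  let I₁ := ((Lt.monoTeleOver hN hψ).μ (telE v ν₁ hν₁)).app (((Lt.monoTeleOver hN hψ).N a).obj x)
  let I₂ := ((Lt.monoTeleOver hN hψ).μ (telE v ν₂ hν₂)).app (((Lt.monoTeleOver hN hψ).N a).obj x)
  have hp' : ((Lt.monoTeleOver hN hψ).N (nmonoPlusVx v)).map ((Lt.Θ hN hψ hη hp.wit).hom.app x) =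
      ((Lt.monoTeleOver hN hψ).pathIso p).hom.app x ≫ I₁.inv :=
    (Iso.eq_comp_inv I₁).mpr (Lt.Θ_over hN hψ hη hcoh hp.wit x)
  have hq' : ((Lt.monoTeleOver hN hψ).N (nmonoPlusVx v)).mapIso ((Lt.Θ hN hψ hη hq.wit).app x) =
      ((Lt.monoTeleOver hN hψ).pathIso q).app x ≪≫ I₂.symm :=
    Iso.ext ((Iso.eq_comp_inv I₂).mpr (Lt.Θ_over hN hψ hη hcoh hq.wit x))
  have hq'' : ((Lt.monoTeleOver hN hψ).N (nmonoPlusVx v)).map ((Lt.Θ hN hψ hη hq.wit).inv.app x) =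
      I₂.hom ≫ ((Lt.monoTeleOver hN hψ).pathIso q).inv.app x := by
    change (((Lt.monoTeleOver hN hψ).N (nmonoPlusVx v)).mapIso ((Lt.Θ hN hψ hη hq.wit).app x)).inv = _
    rw [hq']
    rfl
  have hc : I₁.inv ≫ (((Lt.monoTeleOver hN hψ).N (nmonoPlusVx v)).map
      ((Ia.chain v h12).app (((Lt.monoTeleOver hN hψ).N a).obj x)) ≫ I₂.hom) = 𝟙 _ :=
    (Iso.inv_comp_eq I₁).mpr ((Lt.map_chain_app_comp_μ hN hψ Ia h12 _).trans (Category.comp_id _).symm)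
  have hk : I₁.inv ≫ (((Lt.monoTeleOver hN hψ).N (nmonoPlusVx v)).map
      ((Ia.chain v h12).app (((Lt.monoTeleOver hN hψ).N a).obj x)) ≫
        (I₂.hom ≫ ((Lt.monoTeleOver hN hψ).pathIso q).inv.app x)) = ((Lt.monoTeleOver hN hψ).pathIso q).inv.app x :=
    (congrArg (fun k => I₁.inv ≫ k) (Category.assoc _ _ _).symm).trans
      (((Category.assoc _ _ _).symm).trans ((congrArg (fun k => k ≫ _) hc).trans (Category.id_comp _)))
  rw [hp', hq'']
  first
    | exact congrArg (fun k => ((Lt.monoTeleOver hN hψ).pathIso p).hom.app x ≫ k) hk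
    | exact (Category.assoc _ _ _).trans
        (congrArg (fun k => ((Lt.monoTeleOver hN hψ).pathIso p).hom.app x ≫ k) hk)

/-! ### Pre-composition -/

/-- **pre-composition law** (Def 3.5 (ii) whiskering): the structure isomorphisms of the prefix cancel through the
naturality of the chain. [cite: MochizukiAbsTopIII2015, Definition 3.5 (ii) p.75] -/
theorem θI_precomp_heq {c : (monoTeleShape Vmod isArc).Vertex} (r : Path c a) {p q : Path a (nmonoPlusVx v)}
    (hr : MRelI p q) (hr' : MRelI (r.comp p) (r.comp q)) :
    Lt.θI hN hψ hη Ia hr' ≍ Functor.whiskerLeft (Lt.monoTeleDiagram.pathFunctor r) (Lt.θI hN hψ hη Ia hr) := by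
  obtain ⟨ν₁, ν₂, hν₁, hν₂, hp, hq, h12⟩ := (mrelI_nmonoPlus_iff p q).mp hr
  have hp' : InA v ν₁ hν₁ (r.comp p) := hp.precomp r
  have hq' : InA v ν₂ hν₂ (r.comp q) := hq.precomp r
  rw [Lt.θI_eq hN hψ hη Ia hr hp.wit hq.wit h12, Lt.θI_eq hN hψ hη Ia hr' hp'.wit hq'.wit h12]
  refine natTrans_heq_of_app (DiagramOfCategories.pathFunctor_comp _ _ _) (DiagramOfCategories.pathFunctor_comp _ _ _)
    fun x => ?_
  simp only [NatTrans.comp_app, Functor.whiskerLeft_app]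
  have e₁ := Lt.Θ_hom_app_precomp_heq hN hψ hη r hp.wit hp'.wit x
  have e₂ := Lt.Θ_inv_app_precomp_heq hN hψ hη r hq.wit hq'.wit x
  -- the middle: `(N_c ◁ chain)_x = chain_{N_c x}` versus `chain_{N_a (r x)}` conjugated by `ψ(π_r)` (naturality)
  have emid : (Ia.chain v h12).app (((Lt.monoTeleOver hN hψ).N c).obj x) =
      (Lt.ψAnMono v ⟨ν₁, hν₁⟩).map (((Lt.monoTeleOver hN hψ).pathIso r).inv.app x) ≫
        (Ia.chain v h12).app (((Lt.monoTeleOver hN hψ).N a).obj ((Lt.monoTeleDiagram.pathFunctor r).obj x)) ≫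
          (Lt.ψAnMono v ⟨ν₂, hν₂⟩).map (((Lt.monoTeleOver hN hψ).pathIso r).hom.app x) := by
    erw [← Category.assoc, Ia.chain_naturality v h12 (((Lt.monoTeleOver hN hψ).pathIso r).inv.app x), Category.assoc,
      ← Functor.map_comp, Iso.inv_hom_id_app, CategoryTheory.Functor.map_id, Category.comp_id]
  rw [emid]
  refine (heq_comp (Functor.congr_obj (DiagramOfCategories.pathFunctor_comp _ r p) x) rfl
    (Functor.congr_obj (DiagramOfCategories.pathFunctor_comp _ r q) x) e₁
    (heq_comp rfl rfl (Functor.congr_obj (DiagramOfCategories.pathFunctor_comp _ r q) x) HEq.rfl e₂)).trans ?_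
  apply heq_of_eq
  erw [Category.assoc, Category.assoc, Category.assoc]
  erw [← Category.assoc ((Lt.ψAnMono v ⟨ν₁, hν₁⟩).map _) ((Lt.ψAnMono v ⟨ν₁, hν₁⟩).map _), ← Functor.map_comp,
    Iso.hom_inv_id_app, CategoryTheory.Functor.map_id]
  erw [Category.id_comp]
  erw [← Category.assoc ((Lt.ψAnMono v ⟨ν₂, hν₂⟩).map _) ((Lt.ψAnMono v ⟨ν₂, hν₂⟩).map _), ← Functor.map_comp,
    Iso.hom_inv_id_app, CategoryTheory.Functor.map_id]
  erw [Category.id_comp]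
  rfl

/-! ### Post-composition by a telecore edge -/

/-- post-composition by `[φ^{An⊢⊞}_{v′,ν′}] ∘ [τ]` of any homotopy lying over the structure isomorphisms: the composites fall
into ONE class, where the extended lift is abc-iut-f-101's framed lift (`θAt_comp_tel_heq`).
[cite: MochizukiAbsTopIII2015, Definition 3.5 (ii) p.75] -/
theorem θI_comp_tel_heq {a₀ w : (monoTeleShape Vmod isArc).Vertex} {p q : Path a₀ w}
    (θ₀ : Lt.monoTeleDiagram.pathFunctor p ⟶ Lt.monoTeleDiagram.pathFunctor q)
    (hover : ∀ x, ((Lt.monoTeleOver hN hψ).N w).map (θ₀.app x) =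
      ((Lt.monoTeleOver hN hψ).pathIso p).hom.app x ≫ ((Lt.monoTeleOver hN hψ).pathIso q).inv.app x)
    (t : Path w (coreVx Vmod isArc)) {v' : Vmod} (ν' : LogVertex (isArc v')) (hν' : ν'.IsCross)
    (hr : MRelI (p.comp (t.cons (telE v' ν' hν'))) (q.comp (t.cons (telE v' ν' hν')))) :
    Lt.θI hN hψ hη Ia hr ≍ Functor.whiskerRight θ₀ (Lt.monoTeleDiagram.pathFunctor (t.cons (telE v' ν' hν'))) := by
  have hr' : MRel (p.comp (t.cons (telE v' ν' hν'))) (q.comp (t.cons (telE v' ν' hν'))) :=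
    ⟨ν', hν', Or.inl ⟨⟨p.comp t, rfl⟩⟩, Or.inl ⟨⟨q.comp t, rfl⟩⟩⟩
  rw [Lt.θI_eq_θAt hN hψ hη Ia hr hr']
  exact Lt.θAt_comp_tel_heq hN hψ hη θ₀ hover t ν' hν' hr'

end Theta

end LogFrobeniusSettingLtimes

end Literature.AnabelianGeometry.AbsoluteAnabelian
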